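import Literature.NumberTheory.PAdicHodge.TateEigenvectorCoefficients
import Mathlib.FieldTheory.Galois.Infinite
import HarnessLib

/-!
# Tate's theorem `H⁰(G₀, ℂ_F ⊗ E(ψ)) = 0` for a character `ψ` of infinite order on `Gal(K_∞/K₀)`

Topic `Literature/NumberTheory/PAdicHodge`; namespace `Literature.NumberTheory.PAdicHodge.TateTrace`. THEOREMS ONLY (no
definition, no instance, no notation, no named fact). Continuation of `TateEigenvectorCoefficients`; notation as there:
`K₀ = PadicBase F p hp ≅ ℚ_p`, `F̄ = NormedAlgClosure F`, `ℂ_F = CompletedAlgClosure F`, `G₀ = BaseGaloisGroup hp = Gal(F̄/K₀)`,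
`ζ_{p^M} = zeta F p M`, `K M = K₀(ζ_{p^M})`, `K_∞ = ⋃_M K M`, `H = Gal(F̄/K_∞) = {g | ∀ M, g ζ_{p^M} = ζ_{p^M}}`,
`X = \widehat{K_∞}`, `γ = gen n`, `ι : K₀ → ℂ_F`; `E` is a field with a finite `K₀`-basis `b : κ` and
`L = Algebra.leftMulMatrix b : E → Matrix κ κ K₀` its regular representation.

A character `ψ : G₀ → E^×` and a vector `x⃗ : κ → ℂ_F` with `g • x_k = Σ_m ι(L(ψ g)_{k m}) x_m` for all `g ∈ G₀`
(the coordinates, in the `K₀`-basis `b ⊗ 1`, of a `G₀`-invariant element of `(E ⊗_{K₀} ℂ_F)(ψ)`) are the data of the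
`H⁰` in the title. This file proves the GROUP-THEORETIC conclusion of Tate's theorem in the coefficient setting of
[SerreAbelianLadic1968, Ch. III, Appendix]:

* `mem_X_of_forall_smul_eq_sum` — if `ψ(H) = 1`, every coordinate `x_k` lies in `X = ℂ_F^H` (Ax–Sen–Tate,
  `fixedPoints_eq_X`);
* `exists_forall_gen_eq_one` — if moreover `x⃗ ≠ 0` and `ψ` is continuous ALONG THE TOWER (`∀ ε > 0 ∃ M`,
  `‖L(ψ g) − 1‖ < ε` for all `g` fixing `ζ_{p^M}`), then `ψ(γ_n) = 1` for all large `n` — the eigenvector lemma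
  with matrix coefficients `eq_one_of_gen_smul_eq_leftMulMatrix` at a level where `‖L(ψ γ_n) − 1‖ < ‖p‖²`;
* ★ `exists_level_eq_one_of_semiInvariant` — **under the same hypotheses `ψ` is trivial on `Gal(F̄/K N)` for some `N`**:
  `Gal(K M/K n) = ⟨γ_n⟩` (every `g` fixing `ζ_{p^n}` acts on `ζ_{p^M}` as a power of `γ_n`, `2 ≤ n < M`; the cyclic
  group `(1 + p^n ℤ)/(1 + p^M ℤ)` is generated by `1 + p^n a`, `p ∤ a` — private copies of
  `TateTraceFixedField.exists_pow_gen_smul_eq_of_smul_zeta_eq` / `PrincipalUnitPowers.exists_pow_modEq_of_modEq_one`,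
  whose import closure (`TateLogCyclotomicClass`) we avoid), so `ψ g = ψ g'` with `g'` as deep in the tower as we
  please, and `‖L(ψ g) − 1‖ < ε` for every `ε`;
* `exists_level_of_eventually` — the tower form of continuity from Krull continuity: a neighbourhood of `1` in `G₀`
  stable under left multiplication by `H` contains `Gal(F̄/K N)` for some `N` (compactness of `G₀ = Gal(F̄/K₀)`,
  Mathlib `InfiniteGalois`, and `⋂_N Gal(F̄/K N) = H`); hence ★★ `exists_level_eq_one_of_semiInvariant_of_eventually` —
  **a Krull-continuous `ψ : G₀ → E^×` with `ψ(H) = 1` admitting a nonzero semi-invariant vector `x⃗` is trivial on an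
  open subgroup `Gal(F̄/K N)`**, i.e. `ψ` has finite order on `Gal(K_∞/K₀) ≅ ℤ_p^×`.

Contrapositively: `(E ⊗ ℂ_F)(ψ)^{G₀} = 0` whenever `ψ` factors through `Gal(K_∞/K₀)` with infinite image — the `H⁰`
half of [Tate1967, §3.3 Theorem 2] for characters with values in a coefficient field `E ⊋ ℚ_p`, the form used in
Tate's proof that a Hodge–Tate character of weight `0` of `Gal(ℚ̄_p/ℚ_p)` is finite on inertia
[SerreAbelianLadic1968, Ch. III, Appendix, Theorem 2 and its Corollary]. The tree had the scalar case `E = ℚ_p`,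
`ψ = χ_cyc^j` (`CompletedAlgClosure.eq_zero_of_forall_base_smul_eq`) and the matrix eigenvector lemma
(`TateEigenvectorCoefficients`). Section numbers for [Tate1967] follow the citations of `TateInvariantsBase`.

## References

* J. Tate, *p-divisible groups* (1967), §3.1 (the tower, `Gal(K_∞/K_n)` generated by `γ_n`), §3.3 Theorem 2. [Tate1967]
* J.-P. Serre, *Abelian ℓ-adic representations and elliptic curves* (1968), Ch. III, Appendix (Hodge–Tate modules with
  coefficients; Tate's theorem and its corollary on characters). [SerreAbelianLadic1968]
* J.-P. Serre, *A Course in Arithmetic*, Ch. II §3.2 (`1 + p^n ℤ_p`). [Serre1973]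
* J.-M. Fontaine, Y. Ouyang, *Theory of p-adic Galois representations*, §3.1. [FontaineOuyang2022]
-/

noncomputable section

open ValuativeRel Field UniformSpace Filter Topology Finset

open scoped IntermediateField Matrix Pointwise

namespace Literature.NumberTheory.PAdicHodge

namespace PrincipalUnitPowers

variable {p : ℕ} (hp : p.Prime)
include hp

/-- `1 + p^j a` generates `(1 + p^j ℤ)/(1 + p^M ℤ)` (`2 ≤ j ≤ M`, `p ∤ a`): every `c ≡ 1 (mod p^j)` is a power
`(1 + p^j a)^k` modulo `p^M`. Private copy of `TateTraceFixedField`'s `exists_pow_modEq_of_modEq_one` (that file imports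
`TateLogCyclotomicClass`; we keep the import closure at `TateEigenvectorCoefficients`). [cite: Serre1973, Ch. II §3.2] -/
private theorem exists_pow_congr_of_congr_one {j M : ℕ} (hj : 2 ≤ j) (hjM : j ≤ M) {a : ℕ} (ha : ¬p ∣ a)
    {c : ℕ} (hc : c ≡ 1 [MOD p ^ j]) :
    ∃ k : ℕ, (1 + p ^ j * a) ^ k ≡ c [MOD p ^ M] := by
  classical
  have hpj : 0 < p ^ j := pow_pos hp.pos j
  have hpM : 0 < p ^ M := pow_pos hp.pos M
  have hNM : p ^ j * p ^ (M - j) = p ^ M := by rw [← pow_add]; congr 1; omega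
  set r := c % p ^ M with hr
  have hr1 : r % p ^ j = 1 := by
    rw [hr, Nat.mod_mod_of_dvd _ (pow_dvd_pow p hjM), hc]
    exact Nat.mod_eq_of_lt (Nat.one_lt_pow (by omega) hp.one_lt)
  have hrlt : r < p ^ M := Nat.mod_lt _ hpM
  have ht₀lt : r / p ^ j < p ^ (M - j) := by
    rw [Nat.div_lt_iff_lt_mul hpj, mul_comm, hNM]; exact hrlt
  have hrt : 1 + p ^ j * (r / p ^ j) = r := by
    have := Nat.div_add_mod r (p ^ j)
    rw [hr1] at this
    omega
  have hsum := sum_pow_mod_eq_sum hp hj hjM ha (fun x => if x = r then (1 : ℕ) else 0)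
  have hpos : 0 < ∑ t ∈ Finset.range (p ^ (M - j)), (if 1 + p ^ j * t = r then (1 : ℕ) else 0) := by
    refine Nat.pos_of_ne_zero fun h0 => ?_
    have := (Finset.sum_eq_zero_iff.mp h0) (r / p ^ j) (Finset.mem_range.mpr ht₀lt)
    rw [if_pos hrt] at this
    exact one_ne_zero this
  rw [← hsum] at hpos
  obtain ⟨k, -, hk0⟩ := Finset.exists_ne_zero_of_sum_ne_zero hpos.ne'
  refine ⟨k, ?_⟩
  by_cases hkr : (1 + p ^ j * a) ^ k % p ^ M = r
  · exact hkr
  · rw [if_neg hkr] at hk0; exact absurd rfl hk0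

end PrincipalUnitPowers

open Literature.NumberTheory.GaloisRepresentations
open Literature.NumberTheory.GaloisRepresentations.IsNonarchimedeanLocalField
open CyclotomicTower

variable {F : Type} [Field F] [ValuativeRel F] [TopologicalSpace F] [IsNonarchimedeanLocalField F]
  [CharZero F] {p : ℕ} [Fact p.Prime] (hp : valuation F p < 1)

namespace TateTrace

/-! ### The tower `Gal(F̄/K N)` and its generator -/

/-- `Gal(F̄/K N') ⊆ Gal(F̄/K N)` for `N ≤ N'`: fixing `ζ_{p^{N'}}` fixes its power `ζ_{p^N}`. [cite: Tate1967, §3.1] -/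
theorem smul_zeta_eq_of_level_le {N N' : ℕ} (h : N ≤ N') {g : BaseGaloisGroup hp}
    (hg : g • zeta F p N' = zeta F p N') : g • zeta F p N = zeta F p N := by
  obtain ⟨i, hi⟩ := exists_zeta_eq_pow (F := F) (p := p) h
  rw [hi, smul_pow', hg]

/-- An element fixing `ζ_{p^n}` acts on `ζ_{p^M}` (`n ≤ M`) by an exponent `c ≡ 1 (mod p^n)` (its cyclotomic
character). Private copy of `TateTraceFixedField`'s `exists_smul_zeta_eq_pow_of_smul_zeta_eq`. [cite: Tate1967, §3.1] -/
private theorem exists_congr_one_smul_zeta_eq_pow {n M : ℕ} (hnM : n ≤ M) {g : BaseGaloisGroup hp}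
    (hg : g • zeta F p n = zeta F p n) :
    ∃ c : ℕ, c ≡ 1 [MOD p ^ n] ∧ g • zeta F p M = zeta F p M ^ c := by
  set z : ℤ_[p] := (BaseGaloisGroup.baseCyclotomicCharacter hp g : ℤ_[p]) with hz
  refine ⟨(PadicInt.toZModPow M z).val, ?_, ?_⟩
  · have h1 : PadicInt.toZModPow n z = 1 := toZModPow_chi_eq_one hp hg
    have h2 : (ZMod.castHom (pow_dvd_pow p hnM) (ZMod (p ^ n))) (PadicInt.toZModPow M z) =
        PadicInt.toZModPow n z := by
      rw [← RingHom.comp_apply, PadicInt.zmod_cast_comp_toZModPow _ _ hnM]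
    rw [h1, ZMod.castHom_apply, ZMod.cast_eq_val] at h2
    rw [← ZMod.natCast_eq_natCast_iff, Nat.cast_one]
    exact h2
  · exact BaseGaloisGroup.baseCyclotomicCharacter_spec hp g (zeta F p M) (zeta_spec F p M).pow_eq_one

/-- **`Gal(K M / K n) = ⟨γ_n⟩` on `ζ_{p^M}`** (`2 ≤ n < M`): an element of `G₀` fixing `ζ_{p^n}` acts on `ζ_{p^M}` as a
power of `γ = gen n` (variant of `TateTraceFixedField`'s `exists_pow_gen_smul_eq_of_smul_zeta_eq`, same proof).
[cite: Tate1967, §3.1] [cite: Serre1973, Ch. II §3.2] -/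
theorem exists_pow_gen_smul_zeta_eq {n M : ℕ} (hn : 2 ≤ n) (hM : n + 1 ≤ M) {g : BaseGaloisGroup hp}
    (hg : g • zeta F p n = zeta F p n) : ∃ k : ℕ, g • zeta F p M = gen hp n ^ k • zeta F p M := by
  have hpP : p.Prime := Fact.out
  obtain ⟨c, hc, hgc⟩ := exists_congr_one_smul_zeta_eq_pow hp (M := M) (by omega) hg
  obtain ⟨a, ha, hγ⟩ := exists_gen_smul_zeta hp (by omega : 1 ≤ n) hM
  obtain ⟨k, hk⟩ := PrincipalUnitPowers.exists_pow_congr_of_congr_one hpP (M := M) hn (by omega) ha hc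
  refine ⟨k, ?_⟩
  rw [hgc, pow_smul_eq_pow_pow hp hγ k]
  have hfin : IsOfFinOrder (zeta F p M) :=
    isOfFinOrder_iff_pow_eq_one.mpr ⟨p ^ M, pow_pos' M, (zeta_spec F p M).pow_eq_one⟩
  refine (hfin.pow_eq_pow_iff_modEq).mpr ?_
  rw [← (zeta_spec F p M).eq_orderOf]
  exact hk.symm

/-! ### Semi-invariant vectors for a character trivial on `H` lie in `X` -/

section Coefficients

variable {E : Type} [Field E] [Algebra (PadicBase F p hp) E] {κ : Type} [Fintype κ] [DecidableEq κ]
  (b : Module.Basis κ (PadicBase F p hp) E) (ψ : BaseGaloisGroup hp →* Eˣ)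

/-- `Σ_m ι(1_{k m}) x_m = x_k`. [folklore] -/
private theorem sum_ι_one_mul (x : κ → CompletedAlgClosure F) (k : κ) :
    ∑ m, ι hp ((1 : Matrix κ κ (PadicBase F p hp)) k m) * x m = x k := by
  rw [Finset.sum_eq_single k, Matrix.one_apply_eq, ← ιHom_apply, map_one, one_mul]
  · intro m _ hm; rw [Matrix.one_apply_ne' hm, ← ιHom_apply, map_zero, zero_mul]
  · intro h; exact absurd (Finset.mem_univ k) h

/-- **The coordinates of a semi-invariant vector lie in `X = \widehat{K_∞}`** when `ψ` is trivial on
`H = Gal(F̄/K_∞)`: for `h ∈ H`, `h • x_k = Σ_m ι(L(1)_{k m}) x_m = x_k`, and `ℂ_F^H = X` (Ax–Sen–Tate).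
[cite: Tate1967, §3.3 Theorem 1] -/
theorem mem_X_of_forall_smul_eq_sum
    (hH : ∀ g : BaseGaloisGroup hp, (∀ M, g • zeta F p M = zeta F p M) → ψ g = 1)
    {x : κ → CompletedAlgClosure F}
    (hγ : ∀ (g : BaseGaloisGroup hp) (k : κ),
      g • x k = ∑ m, ι hp (Algebra.leftMulMatrix b (ψ g : E) k m) * x m)
    (k : κ) : x k ∈ X hp := by
  have hfix : x k ∈ {y : CompletedAlgClosure F |
      ∀ g : BaseGaloisGroup hp, (∀ M, g • zeta F p M = zeta F p M) → g • y = y} := by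
    intro g hg
    rw [hγ g k, hH g hg, Units.val_one, map_one, sum_ι_one_mul hp x k]
  rwa [fixedPoints_eq_X hp] at hfix

/-! ### `ψ(γ_n) = 1` for large `n` -/

/-- **`ψ(γ_n) = 1` for all large `n`.** If `ψ(H) = 1`, `ψ` is continuous along the tower (`∀ ε > 0 ∃ M`: `g` fixing
`ζ_{p^M}` ⇒ `‖(L(ψ g) − 1)_{k m}‖ < ε`) and `x⃗ ≠ 0` is `ψ`-semi-invariant, then there is `n₀ ≥ 2` with `ψ(γ_n) = 1`
for every `n ≥ n₀`: `γ_n` fixes `ζ_{p^{M}}` for the `M` belonging to `ε = ‖p‖²` (`n ≥ M`), so the eigenvector lemma with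
matrix coefficients applies. [cite: Tate1967, §3.3 Theorem 2] [cite: SerreAbelianLadic1968, Ch. III, Appendix] -/
theorem exists_forall_gen_eq_one
    (hH : ∀ g : BaseGaloisGroup hp, (∀ M, g • zeta F p M = zeta F p M) → ψ g = 1)
    (hcont : ∀ ε : ℝ, 0 < ε → ∃ M : ℕ, ∀ g : BaseGaloisGroup hp, g • zeta F p M = zeta F p M →
      ∀ k m, ‖(Algebra.leftMulMatrix b (ψ g : E) - 1) k m‖ < ε)
    {x : κ → CompletedAlgClosure F} (hx0 : x ≠ 0)
    (hγ : ∀ (g : BaseGaloisGroup hp) (k : κ),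
      g • x k = ∑ m, ι hp (Algebra.leftMulMatrix b (ψ g : E) k m) * x m) :
    ∃ n₀ : ℕ, 2 ≤ n₀ ∧ ∀ n, n₀ ≤ n → ψ (gen hp n) = 1 := by
  have hp0 : 0 < ‖(p : PadicBase F p hp)‖ := PadicBase.norm_p_pos hp
  obtain ⟨M₀, hM₀⟩ := hcont (‖(p : PadicBase F p hp)‖ ^ 2) (pow_pos hp0 2)
  refine ⟨max M₀ 2, le_max_right _ _, fun n hn => ?_⟩
  have hn2 : 2 ≤ n := le_trans (le_max_right _ _) hn
  have hnM : M₀ ≤ n := le_trans (le_max_left _ _) hn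
  have hfix : gen hp n • zeta F p M₀ = zeta F p M₀ := gen_smul_zeta_of_le hp (by omega) hnM
  have hsmall : ∀ k m, ‖(p : PadicBase F p hp)‖⁻¹ ^ 2 *
      ‖(Algebra.leftMulMatrix b (ψ (gen hp n) : E) - 1) k m‖ < 1 := by
    intro k m
    have h1 : ‖(p : PadicBase F p hp)‖⁻¹ ^ 2 * ‖(p : PadicBase F p hp)‖ ^ 2 = 1 := by
      rw [← mul_pow, inv_mul_cancel₀ hp0.ne', one_pow]
    calc ‖(p : PadicBase F p hp)‖⁻¹ ^ 2 * ‖(Algebra.leftMulMatrix b (ψ (gen hp n) : E) - 1) k m‖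
        < ‖(p : PadicBase F p hp)‖⁻¹ ^ 2 * ‖(p : PadicBase F p hp)‖ ^ 2 :=
          mul_lt_mul_of_pos_left (hM₀ _ hfix k m) (pow_pos (inv_pos.mpr hp0) 2)
      _ = 1 := h1
  have hxX : ∀ k, x k ∈ X hp := mem_X_of_forall_smul_eq_sum hp b ψ hH hγ
  exact Units.val_eq_one.mp
    (eq_one_of_gen_smul_eq_leftMulMatrix hp hn2 b hsmall hxX hx0 (fun k => hγ (gen hp n) k))

/-! ### ★ `ψ` is trivial on `Gal(F̄/K N)` -/

/-- ★ **Tate's theorem (group-theoretic conclusion, coefficients in `E`).** Let `ψ : G₀ → E^×` be trivial on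
`H = Gal(F̄/K_∞)` and continuous along the cyclotomic tower, and let `x⃗ : κ → ℂ_F` be a NONZERO vector with
`g • x_k = Σ_m ι(L(ψ g)_{k m}) x_m` for all `g ∈ G₀`. Then `ψ` is trivial on `Gal(F̄/K N) = {g | g ζ_{p^N} = ζ_{p^N}}`
for some `N`. Proof: with `n₀` from `exists_forall_gen_eq_one` take `N = n₀`; for `g` fixing `ζ_{p^{n₀}}` and any
level `M' > n₀`, `g` acts on `ζ_{p^{M'}}` as `γ_{n₀}^k`, so `g' = γ_{n₀}^{-k} g` fixes `ζ_{p^{M'}}` and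
`ψ g = ψ g'`; choosing `M'` beyond the level belonging to `ε` gives `‖(L(ψ g) − 1)_{k m}‖ < ε` for every `ε > 0`,
so `L(ψ g) = 1` and `ψ g = 1` (`L` is injective). Equivalently `(E ⊗ ℂ_F)(ψ)^{G₀} = 0` unless `ψ` has finite
order on `Gal(K_∞/K₀)`. [cite: Tate1967, §3.3 Theorem 2] [cite: SerreAbelianLadic1968, Ch. III, Appendix] -/
theorem exists_level_eq_one_of_semiInvariant
    (hH : ∀ g : BaseGaloisGroup hp, (∀ M, g • zeta F p M = zeta F p M) → ψ g = 1)
    (hcont : ∀ ε : ℝ, 0 < ε → ∃ M : ℕ, ∀ g : BaseGaloisGroup hp, g • zeta F p M = zeta F p M →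
      ∀ k m, ‖(Algebra.leftMulMatrix b (ψ g : E) - 1) k m‖ < ε)
    {x : κ → CompletedAlgClosure F} (hx0 : x ≠ 0)
    (hγ : ∀ (g : BaseGaloisGroup hp) (k : κ),
      g • x k = ∑ m, ι hp (Algebra.leftMulMatrix b (ψ g : E) k m) * x m) :
    ∃ N : ℕ, ∀ g : BaseGaloisGroup hp, g • zeta F p N = zeta F p N → ψ g = 1 := by
  obtain ⟨n₀, hn₀, hgen⟩ := exists_forall_gen_eq_one hp b ψ hH hcont hx0 hγ
  refine ⟨n₀, fun g hg => ?_⟩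
  -- every matrix entry of `L(ψ g) - 1` has norm `< ε` for every `ε > 0`
  have hentry : ∀ k m, ‖(Algebra.leftMulMatrix b (ψ g : E) - 1) k m‖ = 0 := by
    intro k m
    refine le_antisymm (le_of_forall_pos_lt_add fun ε hε => ?_) (norm_nonneg _)
    obtain ⟨M, hM⟩ := hcont ε hε
    obtain ⟨j, hj⟩ := exists_pow_gen_smul_zeta_eq hp (M := max M (n₀ + 1)) hn₀ (le_max_right _ _) hg
    set g' : BaseGaloisGroup hp := (gen hp n₀ ^ j)⁻¹ * g with hg'_def
    have hg'M' : g' • zeta F p (max M (n₀ + 1)) = zeta F p (max M (n₀ + 1)) := by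
      rw [hg'_def, mul_smul, hj, ← mul_smul, inv_mul_cancel, one_smul]
    have hg'M : g' • zeta F p M = zeta F p M := smul_zeta_eq_of_level_le hp (le_max_left _ _) hg'M'
    have hψ : ψ g' = ψ g := by
      rw [hg'_def, map_mul, map_inv, map_pow, hgen n₀ le_rfl, one_pow, inv_one, one_mul]
    have h := hM g' hg'M k m
    rw [hψ] at h
    linarith
  have hL : Algebra.leftMulMatrix b (ψ g : E) = Algebra.leftMulMatrix b (1 : E) := by
    rw [map_one, ← sub_eq_zero]
    ext k m
    exact norm_eq_zero.mp (hentry k m)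
  exact Units.val_eq_one.mp (Algebra.leftMulMatrix_injective b hL)

end Coefficients

/-! ### Krull continuity ⇒ continuity along the tower -/

/-- `g ∈ Gal(F̄/K N)` iff `g` fixes `ζ_{p^N}` (`K N = K₀(ζ_{p^N})`; private helper, cf.
`CyclotomicTower.smul_eq_smul_of_smul_zeta_eq`). [folklore] -/
private theorem mem_fixingSubgroup_K_iff (N : ℕ) (g : BaseGaloisGroup hp) :
    g ∈ (K hp N).fixingSubgroup ↔ g • zeta F p N = zeta F p N := by
  rw [IntermediateField.mem_fixingSubgroup_iff]
  constructor
  · intro h; exact h _ (zeta_mem_K hp N)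
  · intro h y hy
    have h1 : g • zeta F p N = (1 : BaseGaloisGroup hp) • zeta F p N := by rw [h, one_smul]
    have := smul_eq_smul_of_smul_zeta_eq hp h1 hy
    rwa [one_smul] at this

/-- **A neighbourhood of `1` in `G₀` stable under `H` contains some `Gal(F̄/K N)`.** For a property `P` holding near
`1` in the Krull topology and invariant under left multiplication by `H = Gal(F̄/K_∞)`: `P` holds on
`Gal(F̄/K N) = {g | g ζ_{p^N} = ζ_{p^N}}` for some `N`. Proof: `P ⊇ H·U` with `U` an open neighbourhood of `1`; the closed
sets `Gal(F̄/K N) ∖ H·U` of the COMPACT group `G₀ = Gal(F̄/K₀)` decrease to `H ∖ H·U = ∅`, so one of them is empty.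
[cite: Tate1967, §3.1] [cite: FontaineOuyang2022, §3.1] -/
theorem exists_level_of_eventually {P : BaseGaloisGroup hp → Prop}
    (hP : ∀ᶠ g in 𝓝 (1 : BaseGaloisGroup hp), P g)
    (hPH : ∀ h g : BaseGaloisGroup hp, (∀ M, h • zeta F p M = zeta F p M) → P g → P (h * g)) :
    ∃ N : ℕ, ∀ g : BaseGaloisGroup hp, g • zeta F p N = zeta F p N → P g := by
  obtain ⟨U, hUP, hUo, h1U⟩ := eventually_nhds_iff.mp hP
  -- `V = H · U` is open, contains `H`, and `P` holds on it
  set Hs : Set (BaseGaloisGroup hp) := {h | ∀ M, h • zeta F p M = zeta F p M} with hHs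
  set V : Set (BaseGaloisGroup hp) := Hs * U with hV
  have hVo : IsOpen V := hUo.mul_left
  have hVP : ∀ g ∈ V, P g := by
    intro g hg
    obtain ⟨h, hh, u, hu, rfl⟩ := Set.mem_mul.mp hg
    exact hPH h u hh (hUP u hu)
  have hHV : ∀ h ∈ Hs, h ∈ V := fun h hh => Set.mem_mul.mpr ⟨h, hh, 1, h1U, mul_one h⟩
  -- the closed sets `Gal(F̄/K N) \ V`
  set t : ℕ → Set (BaseGaloisGroup hp) := fun N => ((K hp N).fixingSubgroup : Set (BaseGaloisGroup hp)) ∩ Vᶜ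
    with ht
  have htc : ∀ N, IsClosed (t N) := by
    intro N
    haveI : FiniteDimensional (PadicBase F p hp) (K hp N) := by
      rw [K_def]
      exact IntermediateField.adjoin.finiteDimensional (Algebra.IsIntegral.isIntegral _)
    exact (IntermediateField.fixingSubgroup_isClosed (K hp N)).inter hVo.isClosed_compl
  have hanti : ∀ {N N' : ℕ}, N ≤ N' → t N' ⊆ t N := by
    intro N N' hNN' g hg
    refine ⟨?_, hg.2⟩
    have h1 : g ∈ (K hp N').fixingSubgroup := hg.1
    rw [SetLike.mem_coe, mem_fixingSubgroup_K_iff hp]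
    exact smul_zeta_eq_of_level_le hp hNN' ((mem_fixingSubgroup_K_iff hp N' g).mp h1)
  have hdir : Directed (fun s₁ s₂ : Set (BaseGaloisGroup hp) => s₁ ⊇ s₂) t :=
    fun i j => ⟨max i j, hanti (le_max_left i j), hanti (le_max_right i j)⟩
  have hempty : (Set.univ : Set (BaseGaloisGroup hp)) ∩ ⋂ N, t N = ∅ := by
    rw [Set.univ_inter, Set.eq_empty_iff_forall_notMem]
    intro g hg
    rw [Set.mem_iInter] at hg
    have hgH : g ∈ Hs := fun M => (mem_fixingSubgroup_K_iff hp M g).mp (hg M).1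
    exact (hg 0).2 (hHV g hgH)
  obtain ⟨N, hN⟩ := isCompact_univ.elim_directed_family_closed t htc hempty hdir
  refine ⟨N, fun g hg => hVP g ?_⟩
  by_contra hgV
  have hgt : g ∈ (Set.univ : Set (BaseGaloisGroup hp)) ∩ t N :=
    ⟨Set.mem_univ g, (mem_fixingSubgroup_K_iff hp N g).mpr hg, hgV⟩
  rw [hN] at hgt
  exact hgt

/-- ★★ **Tate's theorem for a Krull-continuous character.** Let `ψ : G₀ → E^×` be trivial on `H = Gal(F̄/K_∞)` and
continuous at `1` for the Krull topology in the regular representation (`∀ ε > 0`, `‖(L(ψ g) − 1)_{k m}‖ < ε` for `g`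
near `1`), and let `x⃗ ≠ 0` satisfy `g • x_k = Σ_m ι(L(ψ g)_{k m}) x_m` for all `g ∈ G₀`. Then `ψ` is trivial on the
open subgroup `Gal(F̄/K N)` for some `N` — `ψ` has finite order on `Gal(K_∞/K₀) ≅ ℤ_p^×`; equivalently the
semi-invariants `(E ⊗_{K₀} ℂ_F)(ψ)^{G₀}` vanish for `ψ` of infinite order on `Gal(K_∞/K₀)`.
[cite: Tate1967, §3.3 Theorem 2] [cite: SerreAbelianLadic1968, Ch. III, Appendix] -/
theorem exists_level_eq_one_of_semiInvariant_of_eventually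
    {E : Type} [Field E] [Algebra (PadicBase F p hp) E] {κ : Type} [Fintype κ] [DecidableEq κ]
    (b : Module.Basis κ (PadicBase F p hp) E) (ψ : BaseGaloisGroup hp →* Eˣ)
    (hH : ∀ g : BaseGaloisGroup hp, (∀ M, g • zeta F p M = zeta F p M) → ψ g = 1)
    (hcont : ∀ ε : ℝ, 0 < ε → ∀ᶠ g in 𝓝 (1 : BaseGaloisGroup hp),
      ∀ k m, ‖(Algebra.leftMulMatrix b (ψ g : E) - 1) k m‖ < ε)
    {x : κ → CompletedAlgClosure F} (hx0 : x ≠ 0)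
    (hγ : ∀ (g : BaseGaloisGroup hp) (k : κ),
      g • x k = ∑ m, ι hp (Algebra.leftMulMatrix b (ψ g : E) k m) * x m) :
    ∃ N : ℕ, ∀ g : BaseGaloisGroup hp, g • zeta F p N = zeta F p N → ψ g = 1 := by
  refine exists_level_eq_one_of_semiInvariant hp b ψ hH (fun ε hε => ?_) hx0 hγ
  refine exists_level_of_eventually hp (hcont ε hε) fun h g hh hg => ?_
  intro k m
  rw [map_mul, hH h hh, one_mul]
  exact hg k m

end TateTrace

end Literature.NumberTheory.PAdicHodge

end
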